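import Mathlib
import HarnessLib

/-!
# Route `UnthreadedDoor`, crux `PoloidalLiouville` (stmt-NavierStokesRegularity-1222), WALL W1 — crux idea «kinematic-shadow» (ns-idea-15,
# `Cruxes/PoloidalLiouville/KinematicShadowSketch.lean`): the 1-D TRANSPORT CORE of the zonal sub-rung A_z (helper, prover-typed)

KEY-NS #185 / critic sizes 02:08:22Z / prover note `pub/ideators/ns-qj-p1/NOTE-kinematic-shadow-zonal-pointwise-qj-p1-g5.md`.  In the zonal
homogeneous case `T = g(cos θ)` of rung A the steady kinematic law and incompressibility collapse POINTWISE to the transport equation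
`∂_θ W + (ln g′(cos θ))′ · r ∂_r W = −L′(θ)` for `W = g′(cos θ) · r sin θ · u_θ` on the shell `(R,∞) × (0,π)`, with `W → 0` at the poles
(locally uniformly in `r`) and `L = Δ_{S²} T`, `L(0) = −2g′(1) < 0 < 2g′(−1) = L(π)`.  THIS FILE proves the abstract no-go behind the
contradiction, free of any fluid object:

`KinematicShadow.transport_noGo`: let `h > 0` be continuous on `[0,π]` and differentiable on `(0,π)` (`h = g′ ∘ cos`), `L` continuous on `[0,π]`
and differentiable on `(0,π)`, `W` differentiable on `(R,∞) × (0,π)` with `DW(r,θ)·(r h′(θ)/h(θ), 1) = −L′(θ)` there, and `W → 0` as `θ → 0⁺`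
or `θ → π⁻` uniformly for `r` in compact sub-intervals of `(R,∞)`.  Then `L 0 = L π`.  PROOF: along the characteristic `θ ↦ (k·h θ, θ)` (inside
the shell for `k` large) `W + L` has zero derivative, hence is constant on `(0,π)`; its one-sided limits at the poles are `L 0` and `L π`.

HONEST LABEL: a reusable real-analysis helper for an information-grade no-go statement in the LINEAR kinematic shadow (critic V20: W1 movement 0);
the zonal sub-rung itself (the spherical-frame computation) is NOT proved here; `PoloidalLiouville` (1222), W1 and the summit stay OPEN; NO
Navier–Stokes regularity statement is proved.  `--supports stmt-NavierStokesRegularity-1222 --as helper`.  [folklore]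
-/

noncomputable section

-- the summit and its single sub-problem share the name (CONVENTIONS §1)
set_option linter.dupNamespace false

open Set Function Filter Topology

namespace Summit.NavierStokesRegularity.NavierStokesRegularity.Theorems.PoloidalLiouville.KinematicShadow

/-- **Transport no-go along explicit characteristics.**  `h > 0` continuous on `[0,π]`, differentiable on `(0,π)`; `L` continuous on
`[0,π]`, differentiable on `(0,π)`; `W` differentiable on `(R,∞) × (0,π)` with `DW(r,θ)(r·h′θ/hθ, 1) = −L′θ`; `W → 0` at `θ → 0⁺` and
`θ → π⁻` uniformly for `r` in compact sub-intervals of `(R,∞)`.  Then `L 0 = L π`. [folklore] -/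
theorem transport_noGo {W : ℝ × ℝ → ℝ} {L h : ℝ → ℝ} {R : ℝ}
    (hpos : ∀ θ ∈ Icc (0 : ℝ) Real.pi, 0 < h θ) (hhc : ContinuousOn h (Icc 0 Real.pi))
    (hhd : ∀ θ ∈ Ioo (0 : ℝ) Real.pi, DifferentiableAt ℝ h θ)
    (hLc : ContinuousOn L (Icc 0 Real.pi)) (hLd : ∀ θ ∈ Ioo (0 : ℝ) Real.pi, DifferentiableAt ℝ L θ)
    (hW : ∀ p ∈ Ioi R ×ˢ Ioo (0 : ℝ) Real.pi, DifferentiableAt ℝ W p ∧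
        fderiv ℝ W p (p.1 * deriv h p.2 / h p.2, 1) = - deriv L p.2)
    (hbd : ∀ r₁ r₂ : ℝ, R < r₁ → r₁ ≤ r₂ → ∀ ε > 0, ∃ δ > 0,
        ∀ p ∈ Icc r₁ r₂ ×ˢ (Ioo 0 δ ∪ Ioo (Real.pi - δ) Real.pi), |W p| ≤ ε) :
    L 0 = L Real.pi := by
  have hπ : 0 < Real.pi := Real.pi_pos
  have hK : IsCompact (Icc (0 : ℝ) Real.pi) := isCompact_Icc
  have hne : (Icc (0 : ℝ) Real.pi).Nonempty := ⟨0, left_mem_Icc.2 hπ.le⟩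
  -- bounds of `h` on `[0,π]`
  obtain ⟨θm, hθm, hmin⟩ := hK.exists_isMinOn hne hhc
  obtain ⟨θM, hθM, hmax⟩ := hK.exists_isMaxOn hne hhc
  set m : ℝ := h θm with hm
  set Mx : ℝ := h θM with hMx
  have hm0 : 0 < m := hpos θm hθm
  have hmle : ∀ θ ∈ Icc (0 : ℝ) Real.pi, m ≤ h θ := fun θ hθ => hmin hθ
  have hleM : ∀ θ ∈ Icc (0 : ℝ) Real.pi, h θ ≤ Mx := fun θ hθ => hmax hθ
  -- the characteristic `θ ↦ (k · h θ, θ)` with `k · m > R`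
  set k : ℝ := (|R| + 1) / m with hk
  have hk0 : 0 < k := div_pos (by positivity) hm0
  have hkm : R < k * m := by
    rw [hk, div_mul_cancel₀ _ hm0.ne']
    exact (le_abs_self R).trans_lt (lt_add_one _)
  set r₁ : ℝ := k * m with hr₁
  set r₂ : ℝ := k * Mx with hr₂
  have hr12 : r₁ ≤ r₂ := mul_le_mul_of_nonneg_left (hmle θM hθM) hk0.le
  have hγmem : ∀ θ ∈ Icc (0 : ℝ) Real.pi, k * h θ ∈ Icc r₁ r₂ := fun θ hθ =>
    ⟨mul_le_mul_of_nonneg_left (hmle θ hθ) hk0.le, mul_le_mul_of_nonneg_left (hleM θ hθ) hk0.le⟩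
  have hγR : ∀ θ ∈ Icc (0 : ℝ) Real.pi, R < k * h θ := fun θ hθ => hkm.trans_le (hγmem θ hθ).1
  -- the characteristic and `F θ = W (γ θ) + L θ`, which has zero derivative on `(0,π)`
  set γ : ℝ → ℝ × ℝ := fun θ => (k * h θ, θ) with hγdef
  set F : ℝ → ℝ := fun θ => W (γ θ) + L θ with hF
  have hFd : ∀ θ ∈ Ioo (0 : ℝ) Real.pi, HasDerivAt F 0 θ := by
    intro θ hθ
    have hθc : θ ∈ Icc (0 : ℝ) Real.pi := Ioo_subset_Icc_self hθ
    have hp : γ θ ∈ Ioi R ×ˢ Ioo (0 : ℝ) Real.pi := ⟨hγR θ hθc, hθ⟩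
    obtain ⟨hWd, hWe⟩ := hW _ hp
    have hγ : HasDerivAt γ (k * deriv h θ, 1) θ := by
      rw [hγdef]
      exact (((hhd θ hθ).hasDerivAt).const_mul k).prodMk (hasDerivAt_id θ)
    have h1 : HasDerivAt (W ∘ γ) (fderiv ℝ W (γ θ) (k * deriv h θ, 1)) θ :=
      hWd.hasFDerivAt.comp_hasDerivAt θ hγ
    have hvec : ((k * deriv h θ, 1) : ℝ × ℝ) = ((γ θ).1 * deriv h (γ θ).2 / h (γ θ).2, 1) := by
      have hh0 : h θ ≠ 0 := (hpos θ hθc).ne'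
      refine Prod.ext ?_ rfl
      show k * deriv h θ = k * h θ * deriv h θ / h θ
      rw [mul_right_comm, mul_div_cancel_right₀ _ hh0]
    have h2 : fderiv ℝ W (γ θ) (k * deriv h θ, 1) = - deriv L θ := by
      rw [hvec]; exact hWe
    have h3 : HasDerivAt L (deriv L θ) θ := (hLd θ hθ).hasDerivAt
    have h4 := h1.add h3
    rw [h2, neg_add_cancel] at h4
    exact h4
  -- hence `F` is constant on `(0,π)`
  have hFconst : ∀ a b : ℝ, 0 < a → a ≤ b → b < Real.pi → F b = F a := by
    intro a b ha hab hb
    have hsub : Icc a b ⊆ Ioo 0 Real.pi := fun x hx => ⟨ha.trans_le hx.1, lt_of_le_of_lt hx.2 hb⟩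
    have hdiff : DifferentiableOn ℝ F (Icc a b) := fun x hx => (hFd x (hsub hx)).differentiableAt.differentiableWithinAt
    rcases eq_or_lt_of_le hab with h | h
    · rw [h]
    · have hderiv : ∀ x ∈ Ico a b, derivWithin F (Icc a b) x = 0 := fun x hx =>
        (hFd x (hsub (Ico_subset_Icc_self hx))).hasDerivWithinAt.derivWithin
          (uniqueDiffOn_Icc h x (Ico_subset_Icc_self hx))
      exact constant_of_derivWithin_zero hdiff hderiv b (right_mem_Icc.2 hab)
  -- one-sided limits at the poles
  by_contra hne'
  set ε : ℝ := |L 0 - L Real.pi| / 5 with hε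
  have hε0 : 0 < ε := by
    have : 0 < |L 0 - L Real.pi| := abs_pos.2 (sub_ne_zero.2 hne')
    positivity
  obtain ⟨δ, hδ, hδW⟩ := hbd r₁ r₂ hkm hr12 ε hε0
  obtain ⟨δ₀, hδ₀, hL0⟩ := Metric.continuousWithinAt_iff.1 (hLc 0 (left_mem_Icc.2 hπ.le)) ε hε0
  obtain ⟨δπ, hδπ, hLπ⟩ := Metric.continuousWithinAt_iff.1 (hLc Real.pi (right_mem_Icc.2 hπ.le)) ε hε0
  -- a point near `0` and a point near `π`, both in `(0,π)`
  set η : ℝ := min (min δ δ₀) (min δπ Real.pi) / 2 with hη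
  have hηpos : 0 < η := by positivity
  have hηδ : η < δ := by
    have : min (min δ δ₀) (min δπ Real.pi) ≤ δ := (min_le_left _ _).trans (min_le_left _ _)
    rw [hη]; linarith
  have hηδ₀ : η < δ₀ := by
    have : min (min δ δ₀) (min δπ Real.pi) ≤ δ₀ := (min_le_left _ _).trans (min_le_right _ _)
    rw [hη]; linarith
  have hηδπ : η < δπ := by
    have : min (min δ δ₀) (min δπ Real.pi) ≤ δπ := (min_le_right _ _).trans (min_le_left _ _)
    rw [hη]; linarith
  have hη2 : 2 * η ≤ Real.pi := by
    have : min (min δ δ₀) (min δπ Real.pi) ≤ Real.pi := (min_le_right _ _).trans (min_le_right _ _)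
    rw [hη]; linarith
  have hab : η ≤ Real.pi - η := by linarith
  have hbπ : Real.pi - η < Real.pi := by linarith
  have haI : η ∈ Icc (0 : ℝ) Real.pi := ⟨hηpos.le, by linarith⟩
  have hbI : Real.pi - η ∈ Icc (0 : ℝ) Real.pi := ⟨by linarith, hbπ.le⟩
  -- `|W| ≤ ε` at both points, `|L η - L 0| < ε`, `|L (π - η) - L π| < ε`
  have hWa : |W (γ η)| ≤ ε := hδW _ ⟨hγmem η haI, Or.inl ⟨hηpos, hηδ⟩⟩
  have hWb : |W (γ (Real.pi - η))| ≤ ε := hδW _ ⟨hγmem _ hbI, Or.inr ⟨by linarith, hbπ⟩⟩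
  have hLa : dist (L η) (L 0) < ε :=
    hL0 haI (by rw [dist_eq_norm, Real.norm_eq_abs, sub_zero, abs_of_pos hηpos]; exact hηδ₀)
  have hLb : dist (L (Real.pi - η)) (L Real.pi) < ε := hLπ hbI (by
    rw [dist_eq_norm, Real.norm_eq_abs, show Real.pi - η - Real.pi = -η by ring, abs_neg, abs_of_pos hηpos]; exact hηδπ)
  rw [Real.dist_eq] at hLa hLb
  have hFab : F (Real.pi - η) = F η := hFconst η (Real.pi - η) hηpos hab hbπ
  have hFa : |F η - L 0| ≤ 2 * ε := by
    have : F η - L 0 = W (γ η) + (L η - L 0) := by simp only [hF]; ring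
    rw [this]
    calc |W (γ η) + (L η - L 0)| ≤ |W (γ η)| + |L η - L 0| := abs_add_le _ _
      _ ≤ 2 * ε := by linarith [hLa.le]
  have hFb : |F (Real.pi - η) - L Real.pi| ≤ 2 * ε := by
    have : F (Real.pi - η) - L Real.pi = W (γ (Real.pi - η)) + (L (Real.pi - η) - L Real.pi) := by simp only [hF]; ring
    rw [this]
    calc |W (γ (Real.pi - η)) + (L (Real.pi - η) - L Real.pi)|
        ≤ |W (γ (Real.pi - η))| + |L (Real.pi - η) - L Real.pi| := abs_add_le _ _
      _ ≤ 2 * ε := by linarith [hLb.le]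
  have hfin : |L 0 - L Real.pi| ≤ 4 * ε := by
    have e : L 0 - L Real.pi = (F (Real.pi - η) - L Real.pi) - (F η - L 0) := by rw [hFab]; ring
    rw [e]
    calc |(F (Real.pi - η) - L Real.pi) - (F η - L 0)| ≤ |F (Real.pi - η) - L Real.pi| + |F η - L 0| := abs_sub _ _
      _ ≤ 4 * ε := by linarith
  have : |L 0 - L Real.pi| = 5 * ε := by rw [hε]; ring
  linarith [abs_nonneg (L 0 - L Real.pi)]

end Summit.NavierStokesRegularity.NavierStokesRegularity.Theorems.PoloidalLiouville.KinematicShadow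

end
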